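import Literature.NumberTheory.LFunctions.VanDerCorputDerivTests
import Literature.NumberTheory.LFunctions.FordZetaBoundMain
import HarnessLib

/-!
# Ford's exponential-sum bound (Ford 2002, Theorem 2) in the range `1 ≤ λ ≤ 8`, proved by
# van der Corput's `k`-th derivative tests

Topic `Literature/NumberTheory/LFunctions`. Everything in this file is PROVED (no `sorry`, no
named facts). It continues the proved deduction
`Literature.NumberTheory.LFunctions.zeta_bound_ford_of_exp_sum_bound` (`FordZetaBoundMain.lean`)
of Theorem 1 of K. Ford, *Vinogradov's integral and bounds for the Riemann zeta function*, Proc.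
London Math. Soc. (3) 85 (2002), 565–633 (arXiv:1910.08209, whose numbering is used) — the named
fact `Literature.NumberTheory.LFunctions.zeta_bound_ford` — from Theorem 2 of that paper,

  **Theorem 2.** For a positive integer `N ≤ t` and `λ = log t/log N`,
  `S(N, t) := max_{0<u≤1} max_{N<R≤2N} |∑_{N<n≤R} (n+u)^{−it}| ≤ 9.463 N^{1 − 1/(133.66 λ²)}`,

by PROVING Theorem 2 in the range `1 ≤ λ ≤ 8`
(`Literature.NumberTheory.LFunctions.FordVK.expSum_bound_small_lambda`), so that the hypothesis
of the deduction shrinks to Theorem 2 for `λ ≥ 8`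
(`Literature.NumberTheory.LFunctions.zeta_bound_ford_of_exp_sum_bound_large_lambda`). The source
treats `1 ≤ λ ≤ 2.6` by Weyl's method (Lemma 6.2), `2.6 ≤ λ ≤ 87` by a simplified Vinogradov
method with a computed table (Lemmas 6.3–6.8) and `λ ≥ 87` by Theorems 3–4 (explicit bounds for
Vinogradov's integral and for incomplete systems, §§2–5); the last two ranges are the part of
Theorem 2 that remains unproved in the tree.

## Method

For the phase `f(y) = −(t/2π) log(y+u)` one has `e(f(n)) = (n+u)^{−it}` and
`|f^{(k)}(y)| = (t/2π)(k−1)!/(y+u)^k ∈ [λ₀, 2^k λ₀]` on `[N, 2N]`, `λ₀ = (t/2π)(k−1)!/(2(N+u))^k`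
(`VdC.phaseD_bound`). Van der Corput's `k`-th derivative test with Titchmarsh's exponents
(Theorem 5.13: `K = 2^{k−1}`, `‖∑_{a<n≤b} e(f(n))‖ ≪ (b−a) λ^{1/(2K−2)} + (b−a)^{1−2/K} λ^{−1/(2K−2)}`)
is in the tree for `k = 2, 3, 4` with the induction step `VdC.kboundSharp_step`; here it is recorded
for all `k ≥ 2` with the weak explicit constant `12 · 8^{k−2} h` (`FordVK.kboundSharp`). For
`t = N^λ` the test of order `k` saves `N^{(k−λ)/(2^k−2)}` on the main term, against the
`N^{1/(133.66 λ²)}` required, and Ford's bound is weaker than the trivial bound `|∑| ≤ N` unless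
`log N > 133.66 λ² log 9.463 = 300.37… λ²`; at that size of `N` the constants are absorbed as long
as `2^k ≲ 133.66 k²`, which allows `λ` up to about `8.8`. We use `k = 3, 6, 8, 9` on
`λ ∈ [1, 2.8], [2.8, 5.5], [5.5, 7.3], [7.3, 8]`; each interval is one application of the
certificate lemma `FordVK.piece_bound`, whose rational side conditions are closed by `norm_num`
(with `3 < π < 3.15` and `2.7182818283 < e`).

## Main results

* `FordVK.kboundSharp`, `FordVK.kboundSharp_signed` — the `k`-th derivative test with Titchmarsh's
  exponents for every `k ≥ 2` (and its sign wrapper).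
* `FordVK.norm_shifted_sum_le_vdc` — the test applied to `∑_{N<n≤R} (n+u)^{−it}`.
* `FordVK.piece_bound` — one `λ`-interval of Theorem 2 from a rational certificate.
* `FordVK.expSum_bound_small_lambda` — **Theorem 2 for `1 ≤ λ ≤ 8`**:
  `‖∑_{N<n≤R} (n+u)^{−it}‖ ≤ 9.463 N^{1 − (log N)²/(133.66 (log t)²)}` for `1 ≤ N < R ≤ 2N`,
  `N ≤ t ≤ N⁸`, `0 < u ≤ 1`.
* `zeta_bound_ford_of_exp_sum_bound_large_lambda` — `zeta_bound_ford` from Theorem 2 restricted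
  to `t ≥ N⁸`.

## References

* K. Ford, *Vinogradov's integral and bounds for the Riemann zeta function*, Proc. London Math.
  Soc. (3) 85 (2002), 565–633; arXiv:1910.08209 — Theorem 2, Lemma 6.2, §7. (`Ford2002`)
* E. C. Titchmarsh, *The Theory of the Riemann Zeta-Function*, 2nd ed. (rev. D. R. Heath-Brown),
  Oxford 1986, Theorems 5.9, 5.11, 5.13. (`Titchmarsh1986`)
-/

noncomputable section

open Finset Real

namespace Literature.NumberTheory.LFunctions
namespace FordVK

open VdC

/-! ## The `k`-th derivative test with Titchmarsh's exponents, all `k ≥ 2` -/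

/-- **van der Corput's `k`-th derivative test with Titchmarsh's exponents, for every `k = j + 2 ≥ 2`**
(weak absolute constants): if `λ ≤ f^{(k)} ≤ hλ` on `[a, b]` (`h ≥ 1`, `λ > 0`) then
`‖∑_{a<n≤b} e(f(n))‖ ≤ 12 · 8^{k-2} h ((b - a) λ^{1/(2^k - 2)} + (b - a)^{1 - 4/2^k} λ^{-1/(2^k - 2)})`,
i.e. Titchmarsh's Theorem 5.13 with `K = 2^{k-1}` (exponents `1/(2K-2)` and `1 - 2/K`) and the
constant `12 · 8^{k-2} h` in place of an absolute constant times `h^{2/K}`. Induction on `k` by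
`VdC.kboundSharp_step` from the second derivative test `VdC.kboundSharp_two`.
[cite: Titchmarsh1986, Thm 5.13] -/
theorem kboundSharp (j : ℕ) {h : ℝ} (hh : 1 ≤ h) :
    ∀ lam : ℝ, 0 < lam → ∀ a b : ℤ, a < b → ∀ D : ℕ → ℝ → ℝ, DerivFamily D a b (j + 2) →
      (∀ y ∈ Set.Icc (a : ℝ) b, lam ≤ D (j + 2) y ∧ D (j + 2) y ≤ h * lam) →
        ‖∑ n ∈ Finset.Ioc a b, e (D 0 n)‖
          ≤ (12 * 8 ^ j * h) * (((b : ℝ) - a) * lam ^ (1 / ((2 : ℝ) ^ (j + 2) - 2))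
            + ((b : ℝ) - a) ^ (1 - 4 / (2 : ℝ) ^ (j + 2))
              * lam ^ (-(1 / ((2 : ℝ) ^ (j + 2) - 2)))) := by
  induction j with
  | zero =>
    intro lam hlam a b hab D hD hbound
    have := kboundSharp_two hh lam hlam a b hab D hD hbound
    convert this using 3 <;> norm_num
  | succ j ih =>
    intro lam hlam a b hab D hD hbound
    have h8 : (1 : ℝ) ≤ 8 ^ j := one_le_pow₀ (by norm_num)
    have hC : (1 : ℝ) ≤ 12 * 8 ^ j * h := by nlinarith
    have hP : (4 : ℝ) ≤ (2 : ℝ) ^ (j + 2) := by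
      calc (4 : ℝ) = 2 ^ 2 := by norm_num
        _ ≤ 2 ^ (j + 2) := pow_le_pow_right₀ (by norm_num) (by omega)
    have hα0 : 0 < 1 / ((2 : ℝ) ^ (j + 2) - 2) := div_pos one_pos (by linarith)
    have hα1 : 1 / ((2 : ℝ) ^ (j + 2) - 2) ≤ 1 / 2 :=
      div_le_div_of_nonneg_left zero_le_one (by norm_num) (by linarith)
    have hβ0 : 0 < 4 / (2 : ℝ) ^ (j + 2) := by positivity
    have hβ1 : 4 / (2 : ℝ) ^ (j + 2) ≤ 1 := by
      rw [div_le_one (by positivity)]; exact hP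
    have step := kboundSharp_step hC hα0 hα1 hβ0 hβ1 ih lam hlam a b hab D hD hbound
    have hP' : (2 : ℝ) ^ (j + 1 + 2) = 2 * 2 ^ (j + 2) := by ring
    have e1 : 1 / ((2 : ℝ) ^ (j + 2) - 2) / (2 * (1 + 1 / ((2 : ℝ) ^ (j + 2) - 2)))
        = 1 / ((2 : ℝ) ^ (j + 1 + 2) - 2) := by
      rw [hP']
      have h1 : (2 : ℝ) ^ (j + 2) - 2 ≠ 0 := by linarith
      have h2 : (2 : ℝ) * 2 ^ (j + 2) - 2 ≠ 0 := by linarith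
      field_simp
      ring
    have e2 : (1 : ℝ) - 4 / (2 : ℝ) ^ (j + 2) / 2 = 1 - 4 / (2 : ℝ) ^ (j + 1 + 2) := by
      rw [hP']
      have h1 : (2 : ℝ) ^ (j + 2) ≠ 0 := by positivity
      field_simp
    have e3 : (8 : ℝ) * (12 * 8 ^ j * h) = 12 * 8 ^ (j + 1) * h := by ring
    rw [e1, e2, e3] at step
    exact step

/-- Sign wrapper for `kboundSharp`: the same bound when `λ ≤ ε f^{(k)} ≤ hλ` with `ε = ±1`
(conjugate the sum). [folklore] -/
theorem kboundSharp_signed (j : ℕ) {h : ℝ} (hh : 1 ≤ h) {ε : ℝ} (hε : ε = 1 ∨ ε = -1) {lam : ℝ}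
    (hlam : 0 < lam) {a b : ℤ} (hab : a < b) {D : ℕ → ℝ → ℝ} (hD : DerivFamily D a b (j + 2))
    (hbound : ∀ y ∈ Set.Icc (a : ℝ) b, lam ≤ ε * D (j + 2) y ∧ ε * D (j + 2) y ≤ h * lam) :
    ‖∑ n ∈ Finset.Ioc a b, e (D 0 n)‖
      ≤ (12 * 8 ^ j * h) * (((b : ℝ) - a) * lam ^ (1 / ((2 : ℝ) ^ (j + 2) - 2))
        + ((b : ℝ) - a) ^ (1 - 4 / (2 : ℝ) ^ (j + 2))
          * lam ^ (-(1 / ((2 : ℝ) ^ (j + 2) - 2)))) := by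
  set D' : ℕ → ℝ → ℝ := fun i y => ε * D i y with hD'
  have hD'fam : DerivFamily D' a b (j + 2) := fun i hi y hy => (hD i hi y hy).const_mul ε
  have hK := kboundSharp j hh lam hlam a b hab D' hD'fam hbound
  have hnorm : ‖∑ n ∈ Finset.Ioc a b, e (D 0 n)‖ = ‖∑ n ∈ Finset.Ioc a b, e (D' 0 n)‖ := by
    rcases hε with h1 | h1
    · simp [hD', h1]
    · have : ∑ n ∈ Finset.Ioc a b, e (D' 0 n)
          = (starRingEnd ℂ) (∑ n ∈ Finset.Ioc a b, e (D 0 n)) := by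
        rw [map_sum]
        refine Finset.sum_congr rfl fun n _ => ?_
        simp only [hD', h1, neg_mul, one_mul]
        exact e_neg _
      rw [this, Complex.norm_conj]
  rw [hnorm]
  exact hK


/-! ## The shifted zeta sums `∑_{N<n≤R} (n+u)^{-it}` and the `k`-th derivative test -/

/-- `e(D₀(x)) = x^{-it}` for real `x > 0`, `D₀ = phaseD t 0 = -(t/2π) log`. [folklore] -/
theorem e_phaseD_zero_of_pos (t : ℝ) {x : ℝ} (hx : 0 < x) :
    e (phaseD t 0 x) = (x : ℂ) ^ (-(t * Complex.I)) := by
  rw [phaseD_zero, e, Complex.cpow_def_of_ne_zero (by exact_mod_cast hx.ne'),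
    ← Complex.ofReal_log hx.le]
  congr 1
  have hπ : (π : ℂ) ≠ 0 := by exact_mod_cast Real.pi_ne_zero
  push_cast
  field_simp

/-- The shifted sum as a van der Corput sum: `∑_{N<n≤R} (n+u)^{-it} = ∑_{N<n≤R} e(D₀(n+u))`
(`u ≥ 0`). [folklore] -/
theorem sum_shifted_eq_sum_e (N R : ℕ) (t : ℝ) {u : ℝ} (hu : 0 ≤ u) :
    ∑ n ∈ Finset.Ioc N R, ((n : ℂ) + u) ^ (-(t * Complex.I))
      = ∑ n ∈ Finset.Ioc (N : ℤ) (R : ℤ), e (phaseD t 0 ((n : ℝ) + u)) := by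
  rw [sum_Ioc_int_eq_nat]
  refine Finset.sum_congr rfl fun n hn => ?_
  have hn0 : 0 < n := lt_of_le_of_lt (Nat.zero_le N) (Finset.mem_Ioc.1 hn).1
  have hx : 0 < (n : ℝ) + u := by positivity
  rw [Int.cast_natCast, e_phaseD_zero_of_pos t hx]
  push_cast
  rfl

/-- **The `k`-th derivative test applied to `∑_{N<n≤R} (n+u)^{-it}`** (`k = j + 2`, `1 ≤ N < R ≤ 2N`,
`t > 0`, `u > 0`): with `λ₀ = (t/2π) (k-1)! / (2(N+u))^k` (so that `λ₀ ≤ |f^{(k)}| ≤ 2^k λ₀` on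
`[N, R]` for the phase `f(y) = -(t/2π) log(y+u)`),
`‖∑‖ ≤ 12 · 8^{k-2} · 2^k ((R-N) λ₀^{1/(2^k-2)} + (R-N)^{1-4/2^k} λ₀^{-1/(2^k-2)})`.
[cite: Titchmarsh1986, Thm 5.13 (applied)] -/
theorem norm_shifted_sum_le_vdc (j : ℕ) {N R : ℕ} (hN : 1 ≤ N) (hNR : N < R) (hR : R ≤ 2 * N)
    {t u : ℝ} (ht : 0 < t) (hu0 : 0 < u) :
    ‖∑ n ∈ Finset.Ioc N R, ((n : ℂ) + u) ^ (-(t * Complex.I))‖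
      ≤ (12 * 8 ^ j * 2 ^ (j + 2)) *
        (((R : ℝ) - N)
            * (t / (2 * π) * (Nat.factorial (j + 1) : ℝ) / (2 * ((N : ℝ) + u)) ^ (j + 2))
              ^ (1 / ((2 : ℝ) ^ (j + 2) - 2))
          + ((R : ℝ) - N) ^ (1 - 4 / (2 : ℝ) ^ (j + 2))
            * (t / (2 * π) * (Nat.factorial (j + 1) : ℝ) / (2 * ((N : ℝ) + u)) ^ (j + 2))
              ^ (-(1 / ((2 : ℝ) ^ (j + 2) - 2)))) := by
  set lam : ℝ := t / (2 * π) * (Nat.factorial (j + 1) : ℝ) / (2 * ((N : ℝ) + u)) ^ (j + 2)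
    with hlam_def
  set D : ℕ → ℝ → ℝ := fun i y => phaseD t i (y + u) with hD_def
  have hNu : 0 < (N : ℝ) + u := by positivity
  have hDfam : DerivFamily D (N : ℤ) (R : ℤ) (j + 2) := by
    intro i hi y hy
    have hy' : y + u ∈ Set.Icc ((N : ℝ) + u) ((R : ℝ) + u) := by
      simp only [Int.cast_natCast, Set.mem_Icc] at hy
      exact ⟨by linarith [hy.1], by linarith [hy.2]⟩
    have hd := phaseD_derivFamily t (a := (N : ℝ) + u) (b := (R : ℝ) + u) hNu (j + 2) i hi
      (y + u) hy'
    exact hd.comp_add_const y u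
  have hlam : 0 < lam := by
    have := Nat.factorial_pos (j + 1)
    positivity
  have hbound : ∀ y ∈ Set.Icc ((N : ℤ) : ℝ) ((R : ℤ) : ℝ),
      lam ≤ (-1) ^ (j + 2) * D (j + 2) y ∧ (-1) ^ (j + 2) * D (j + 2) y ≤ 2 ^ (j + 2) * lam := by
    intro y hy
    simp only [Int.cast_natCast, Set.mem_Icc] at hy
    have hR' : (R : ℝ) ≤ 2 * N := by exact_mod_cast hR
    have hy' : y + u ∈ Set.Icc ((N : ℝ) + u) (2 * ((N : ℝ) + u)) :=
      ⟨by linarith [hy.1], by linarith [hy.2, hu0.le]⟩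
    have hb := phaseD_bound t ht hNu (j + 1) hy'
    simpa [hD_def, hlam_def] using hb
  have hε : ((-1 : ℝ) ^ (j + 2)) = 1 ∨ ((-1 : ℝ) ^ (j + 2)) = -1 := by
    rcases neg_one_pow_eq_or ℝ (j + 2) with h | h
    · exact Or.inl h
    · exact Or.inr h
  have hab : (N : ℤ) < (R : ℤ) := by exact_mod_cast hNR
  have h2 : (1 : ℝ) ≤ 2 ^ (j + 2) := one_le_pow₀ (by norm_num)
  have hK := kboundSharp_signed j h2 hε hlam hab hDfam hbound
  rw [sum_shifted_eq_sum_e N R t hu0.le]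
  simpa [hD_def, Int.cast_natCast] using hK


/-! ## From the `k`-th derivative test to Ford's bound on one `λ`-interval -/

/-- Certificate for small real powers: `Q ≤ q^m` (`m ≥ 1`) gives `Q^{1/m} ≤ q`. [folklore] -/
theorem rpow_inv_le_of_le_pow {Q q : ℝ} {m : ℕ} (hQ : 0 ≤ Q) (hq : 0 ≤ q) (hm : m ≠ 0)
    (h : Q ≤ q ^ m) : Q ^ (1 / (m : ℝ)) ≤ q := by
  calc Q ^ (1 / (m : ℝ)) ≤ (q ^ m) ^ (1 / (m : ℝ)) := Real.rpow_le_rpow hQ h (by positivity)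
    _ = q := by rw [one_div, Real.pow_rpow_inv_natCast hq hm]

/-- `2.7182818283^m ≤ e^m`. [folklore] -/
theorem exp_nat_ge (m : ℕ) : (2.7182818283 : ℝ) ^ m ≤ Real.exp m := by
  rw [← Real.exp_one_pow]
  exact pow_le_pow_left₀ (by norm_num) Real.exp_one_gt_d9.le m

/-- **One `λ`-interval of Ford's Theorem 2 from the `k`-th derivative test** (`k = j + 2`). For
`1 ≤ N < R ≤ 2N`, `0 < u ≤ 1`, `t > 0` with `lo · log N ≤ log t ≤ hi · log N` and
`log N ≥ 300.3 lo²` (below which Ford's bound is weaker than the trivial one), the bound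
`‖∑_{N<n≤R} (n+u)^{-it}‖ ≤ 9.463 N exp(-log³N / (133.66 log²t))` follows from
`norm_shifted_sum_le_vdc` as soon as the rational certificate `(m₁, q₁, m₂, q₂)` satisfies
`q₁^{2^k-2} ≥ (k-1)!/(2π 2^k)`, `q₂^{2^k-2} ≥ 2π 4^k/(k-1)!`,
`m₁ ≤ 300.3 lo² ((k-hi)/(2^k-2) - 1/(133.66 lo²))`,
`m₂ ≤ 300.3 lo² (4/2^k - (k-lo)/(2^k-2) - 1/(133.66 lo²))` and
`12 · 8^{k-2} 2^k q_i ≤ 4.7315 · 2.7182818283^{m_i}` (`i = 1, 2`).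
[cite: Ford2002, Theorem 2 (range 1 ≤ λ ≤ 8; van der Corput's method in place of Lemma 6.2)] -/
theorem piece_bound (j : ℕ) {lo hi q₁ q₂ : ℝ} {m₁ m₂ : ℕ} {N R : ℕ} {t u : ℝ}
    (hN : 1 ≤ N) (hNR : N < R) (hR : R ≤ 2 * N) (ht : 0 < t) (hu0 : 0 < u) (hu1 : u ≤ 1)
    (hlo0 : 0 < lo) (hlo : lo * Real.log N ≤ Real.log t) (hhi : Real.log t ≤ hi * Real.log N)
    (hn0 : 300.3 * lo ^ 2 ≤ Real.log N)
    (hs₁ : (m₁ : ℝ) ≤ 300.3 * lo ^ 2 *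
      ((j + 2 - hi) / ((2 : ℝ) ^ (j + 2) - 2) - 1 / (133.66 * lo ^ 2)))
    (hq₁0 : 0 ≤ q₁)
    (hq₁ : (Nat.factorial (j + 1) : ℝ) / (2 * π * 2 ^ (j + 2)) ≤ q₁ ^ (2 ^ (j + 2) - 2))
    (h₁ : 12 * 8 ^ j * 2 ^ (j + 2) * q₁ ≤ 4.7315 * 2.7182818283 ^ m₁)
    (hs₂ : (m₂ : ℝ) ≤ 300.3 * lo ^ 2 *
      (4 / (2 : ℝ) ^ (j + 2) - (j + 2 - lo) / ((2 : ℝ) ^ (j + 2) - 2) - 1 / (133.66 * lo ^ 2)))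
    (hq₂0 : 0 ≤ q₂)
    (hq₂ : 2 * π * 4 ^ (j + 2) / (Nat.factorial (j + 1) : ℝ) ≤ q₂ ^ (2 ^ (j + 2) - 2))
    (h₂ : 12 * 8 ^ j * 2 ^ (j + 2) * q₂ ≤ 4.7315 * 2.7182818283 ^ m₂) :
    ‖∑ n ∈ Finset.Ioc N R, ((n : ℂ) + u) ^ (-(t * Complex.I))‖
      ≤ 9.463 * (N : ℝ) * Real.exp (-(Real.log N ^ 3 / (133.66 * Real.log t ^ 2))) := by
  -- notation
  set n : ℝ := Real.log N with hn_def
  set L : ℝ := Real.log t with hL_def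
  set P : ℝ := (2 : ℝ) ^ (j + 2) with hP_def
  set α : ℝ := 1 / (P - 2) with hα_def
  set β : ℝ := 4 / P with hβ_def
  set C : ℝ := 12 * 8 ^ j * 2 ^ (j + 2) with hC_def
  set F : ℝ := (Nat.factorial (j + 1) : ℝ) with hF_def
  set lam₀ : ℝ := t / (2 * π) * F / (2 * ((N : ℝ) + u)) ^ (j + 2) with hlam₀_def
  have hP4 : 4 ≤ P := by
    rw [hP_def]
    calc (4 : ℝ) = 2 ^ 2 := by norm_num
      _ ≤ 2 ^ (j + 2) := pow_le_pow_right₀ (by norm_num) (by omega)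
  have hP0 : 0 < P := by linarith
  have hα0 : 0 < α := div_pos one_pos (by linarith)
  have hβ1 : β ≤ 1 := by rw [hβ_def, div_le_one hP0]; exact hP4
  have hC0 : 0 < C := by positivity
  have hF0 : 0 < F := by rw [hF_def]; exact_mod_cast Nat.factorial_pos (j + 1)
  have hN0 : 0 < (N : ℝ) := by exact_mod_cast hN
  have hNexp : Real.exp n = N := Real.exp_log hN0
  have htexp : Real.exp L = t := Real.exp_log ht
  have hlo2 : 0 < 300.3 * lo ^ 2 := by positivity
  have hnpos : 0 < n := lt_of_lt_of_le hlo2 hn0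
  have hRN : (R : ℝ) - N ≤ N := by
    have : (R : ℝ) ≤ 2 * N := by exact_mod_cast hR
    linarith
  have hRN0 : 0 < (R : ℝ) - N := by
    have : (N : ℝ) < R := by exact_mod_cast hNR
    linarith
  -- the cast of the natural exponent `2^(j+2) - 2`
  have h24 : 4 ≤ 2 ^ (j + 2) := by
    calc 4 = 2 ^ 2 := by norm_num
      _ ≤ 2 ^ (j + 2) := Nat.pow_le_pow_right (by norm_num) (by omega)
  have hm : (((2 ^ (j + 2) - 2 : ℕ)) : ℝ) = P - 2 := by
    rw [Nat.cast_sub (by omega)]; push_cast; rw [hP_def]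
  have hm0 : (2 ^ (j + 2) - 2 : ℕ) ≠ 0 := by omega
  have hα_m : α = 1 / ((2 ^ (j + 2) - 2 : ℕ) : ℝ) := by rw [hm]
  -- Step 1: the k-th derivative test
  have hvdc := norm_shifted_sum_le_vdc j hN hNR hR ht hu0
  -- Step 2: λ₀ between exp(L - k n)/Q₂inv and Q₁ exp(L - k n)
  have hE : Real.exp (L - (j + 2 : ℕ) * n) = t / (N : ℝ) ^ (j + 2) := by
    rw [Real.exp_sub, Real.exp_nat_mul, htexp, hNexp]
  have hE0 : 0 < Real.exp (L - (j + 2 : ℕ) * n) := Real.exp_pos _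
  have hNu' : 2 * ((N : ℝ) + u) ≤ 4 * N := by
    have : (1 : ℝ) ≤ N := by exact_mod_cast hN
    linarith
  have hlamU : lam₀ ≤ F / (2 * π * 2 ^ (j + 2)) * Real.exp (L - (j + 2 : ℕ) * n) := by
    rw [hE]
    have h1 : lam₀ ≤ t / (2 * π) * F / (2 * (N : ℝ)) ^ (j + 2) := by
      rw [hlam₀_def]
      apply div_le_div_of_nonneg_left (by positivity) (by positivity)
      exact pow_le_pow_left₀ (by positivity) (by linarith [hu0.le]) _
    have h2 : t / (2 * π) * F / (2 * (N : ℝ)) ^ (j + 2)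
        = F / (2 * π * 2 ^ (j + 2)) * (t / (N : ℝ) ^ (j + 2)) := by
      rw [mul_pow]; field_simp
    exact h1.trans_eq h2
  have hlamL : Real.exp (L - (j + 2 : ℕ) * n) / (2 * π * 4 ^ (j + 2) / F) ≤ lam₀ := by
    rw [hE]
    have h1 : t / (2 * π) * F / (4 * (N : ℝ)) ^ (j + 2) ≤ lam₀ := by
      rw [hlam₀_def]
      apply div_le_div_of_nonneg_left (by positivity) (by positivity)
      exact pow_le_pow_left₀ (by positivity) hNu' _
    have h2 : t / (2 * π) * F / (4 * (N : ℝ)) ^ (j + 2)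
        = t / (N : ℝ) ^ (j + 2) / (2 * π * 4 ^ (j + 2) / F) := by
      rw [mul_pow]; field_simp
    exact h2.symm.trans_le h1
  have hlam₀0 : 0 < lam₀ := by positivity
  -- Step 3: powers of λ₀
  have hQ₁α : (F / (2 * π * 2 ^ (j + 2))) ^ α ≤ q₁ := by
    rw [hα_m]
    exact rpow_inv_le_of_le_pow (by positivity) hq₁0 hm0 hq₁
  have hQ₂α : (2 * π * 4 ^ (j + 2) / F) ^ α ≤ q₂ := by
    rw [hα_m]
    exact rpow_inv_le_of_le_pow (by positivity) hq₂0 hm0 hq₂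
  have hT1 : lam₀ ^ α ≤ q₁ * Real.exp (α * (L - (j + 2 : ℕ) * n)) := by
    calc lam₀ ^ α ≤ (F / (2 * π * 2 ^ (j + 2)) * Real.exp (L - (j + 2 : ℕ) * n)) ^ α :=
          Real.rpow_le_rpow hlam₀0.le hlamU hα0.le
      _ = (F / (2 * π * 2 ^ (j + 2))) ^ α * Real.exp (α * (L - (j + 2 : ℕ) * n)) := by
          rw [Real.mul_rpow (by positivity) hE0.le, ← Real.exp_mul, mul_comm (L - _)]
      _ ≤ q₁ * Real.exp (α * (L - (j + 2 : ℕ) * n)) :=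
          mul_le_mul_of_nonneg_right hQ₁α (Real.exp_pos _).le
  have hT2 : lam₀ ^ (-α) ≤ q₂ * Real.exp (-(α * (L - (j + 2 : ℕ) * n))) := by
    have hden : 0 < 2 * π * 4 ^ (j + 2) / F := by positivity
    calc lam₀ ^ (-α)
        ≤ (Real.exp (L - (j + 2 : ℕ) * n) / (2 * π * 4 ^ (j + 2) / F)) ^ (-α) :=
          Real.rpow_le_rpow_of_nonpos (by positivity) hlamL (by linarith)
      _ = Real.exp (-(α * (L - (j + 2 : ℕ) * n))) * (2 * π * 4 ^ (j + 2) / F) ^ α := by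
          rw [Real.div_rpow hE0.le hden.le, ← Real.exp_mul, Real.rpow_neg hden.le,
            div_inv_eq_mul]
          congr 1; ring_nf
      _ ≤ Real.exp (-(α * (L - (j + 2 : ℕ) * n))) * q₂ :=
          mul_le_mul_of_nonneg_left hQ₂α (Real.exp_pos _).le
      _ = q₂ * Real.exp (-(α * (L - (j + 2 : ℕ) * n))) := mul_comm _ _
  -- Step 4: the two terms against 4.7315 N exp(-n/(133.66 lo²))
  have hk : ((j + 2 : ℕ) : ℝ) = j + 2 := by push_cast; ring
  have hs₁' : 0 ≤ (j + 2 - hi) * α - 1 / (133.66 * lo ^ 2) := by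
    have h0 : (0 : ℝ) ≤ m₁ := Nat.cast_nonneg _
    have h3 := le_trans h0 hs₁
    have h4 : (j + 2 - hi) / (P - 2) = (j + 2 - hi) * α := by rw [hα_def]; ring
    rw [h4] at h3
    have h5 : 300.3 * lo ^ 2 * 0 ≤ 300.3 * lo ^ 2 * ((j + 2 - hi) * α - 1 / (133.66 * lo ^ 2)) := by
      rw [mul_zero]; exact h3
    exact le_of_mul_le_mul_left h5 hlo2
  have hs₂' : 0 ≤ β - (j + 2 - lo) * α - 1 / (133.66 * lo ^ 2) := by
    have h0 : (0 : ℝ) ≤ m₂ := Nat.cast_nonneg _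
    have h3 := le_trans h0 hs₂
    have h4 : (j + 2 - lo) / (P - 2) = (j + 2 - lo) * α := by rw [hα_def]; ring
    rw [h4] at h3
    have h5 : 300.3 * lo ^ 2 * 0 ≤ 300.3 * lo ^ 2 * (β - (j + 2 - lo) * α - 1 / (133.66 * lo ^ 2)) := by
      rw [mul_zero]; exact h3
    exact le_of_mul_le_mul_left h5 hlo2
  have hexp₁ : C * q₁ ≤ 4.7315 * Real.exp (((j + 2 - hi) * α - 1 / (133.66 * lo ^ 2)) * n) := by
    have h3 : (m₁ : ℝ) ≤ ((j + 2 - hi) * α - 1 / (133.66 * lo ^ 2)) * n := by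
      calc (m₁ : ℝ) ≤ 300.3 * lo ^ 2 * ((j + 2 - hi) / (P - 2) - 1 / (133.66 * lo ^ 2)) := hs₁
        _ = ((j + 2 - hi) * α - 1 / (133.66 * lo ^ 2)) * (300.3 * lo ^ 2) := by
            rw [hα_def]; ring
        _ ≤ ((j + 2 - hi) * α - 1 / (133.66 * lo ^ 2)) * n :=
            mul_le_mul_of_nonneg_left hn0 hs₁'
    calc C * q₁ ≤ 4.7315 * 2.7182818283 ^ m₁ := h₁
      _ ≤ 4.7315 * Real.exp m₁ := by
          have := exp_nat_ge m₁; linarith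
      _ ≤ 4.7315 * Real.exp (((j + 2 - hi) * α - 1 / (133.66 * lo ^ 2)) * n) := by
          have := Real.exp_le_exp.2 h3; linarith
  have hexp₂ : C * q₂ ≤ 4.7315 * Real.exp ((β - (j + 2 - lo) * α - 1 / (133.66 * lo ^ 2)) * n) := by
    have h3 : (m₂ : ℝ) ≤ (β - (j + 2 - lo) * α - 1 / (133.66 * lo ^ 2)) * n := by
      calc (m₂ : ℝ)
          ≤ 300.3 * lo ^ 2 * (4 / P - (j + 2 - lo) / (P - 2) - 1 / (133.66 * lo ^ 2)) := hs₂
        _ = (β - (j + 2 - lo) * α - 1 / (133.66 * lo ^ 2)) * (300.3 * lo ^ 2) := by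
            rw [hα_def, hβ_def]; ring
        _ ≤ (β - (j + 2 - lo) * α - 1 / (133.66 * lo ^ 2)) * n :=
            mul_le_mul_of_nonneg_left hn0 hs₂'
    calc C * q₂ ≤ 4.7315 * 2.7182818283 ^ m₂ := h₂
      _ ≤ 4.7315 * Real.exp m₂ := by
          have := exp_nat_ge m₂; linarith
      _ ≤ 4.7315 * Real.exp ((β - (j + 2 - lo) * α - 1 / (133.66 * lo ^ 2)) * n) := by
          have := Real.exp_le_exp.2 h3; linarith
  have hA : C * (((R : ℝ) - N) * lam₀ ^ α)
      ≤ 4.7315 * N * Real.exp (-(n / (133.66 * lo ^ 2))) := by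
    have h4 : α * (L - (j + 2 : ℕ) * n) ≤ α * ((hi - (j + 2)) * n) := by
      apply mul_le_mul_of_nonneg_left _ hα0.le
      rw [hk]
      have e : (hi - (j + 2)) * n = hi * n - (j + 2) * n := by ring
      rw [e]; linarith
    calc C * (((R : ℝ) - N) * lam₀ ^ α)
        ≤ C * ((N : ℝ) * (q₁ * Real.exp (α * ((hi - (j + 2)) * n)))) := by
          apply mul_le_mul_of_nonneg_left _ hC0.le
          apply mul_le_mul hRN _ (by positivity) hN0.le
          exact hT1.trans (mul_le_mul_of_nonneg_left (Real.exp_le_exp.2 h4) hq₁0)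
      _ = (C * q₁) * ((N : ℝ) * Real.exp (α * ((hi - (j + 2)) * n))) := by ring
      _ ≤ (4.7315 * Real.exp (((j + 2 - hi) * α - 1 / (133.66 * lo ^ 2)) * n))
            * ((N : ℝ) * Real.exp (α * ((hi - (j + 2)) * n))) :=
          mul_le_mul_of_nonneg_right hexp₁ (by positivity)
      _ = 4.7315 * N * (Real.exp (((j + 2 - hi) * α - 1 / (133.66 * lo ^ 2)) * n)
            * Real.exp (α * ((hi - (j + 2)) * n))) := by ring
      _ = 4.7315 * N * Real.exp (-(n / (133.66 * lo ^ 2))) := by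
          rw [← Real.exp_add]; congr 1; ring
  have hB : C * (((R : ℝ) - N) ^ (1 - β) * lam₀ ^ (-α))
      ≤ 4.7315 * N * Real.exp (-(n / (133.66 * lo ^ 2))) := by
    have h4 : -(α * (L - (j + 2 : ℕ) * n)) ≤ α * ((j + 2 - lo) * n) := by
      rw [hk]
      have h6 : α * (lo * n) ≤ α * L := mul_le_mul_of_nonneg_left hlo hα0.le
      have e1 : -(α * (L - (j + 2) * n)) = α * ((j + 2) * n) - α * L := by ring
      have e2 : α * ((j + 2 - lo) * n) = α * ((j + 2) * n) - α * (lo * n) := by ring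
      rw [e1, e2]; linarith
    have h5 : ((R : ℝ) - N) ^ (1 - β) ≤ Real.exp ((1 - β) * n) := by
      calc ((R : ℝ) - N) ^ (1 - β) ≤ (N : ℝ) ^ (1 - β) :=
            Real.rpow_le_rpow hRN0.le hRN (by linarith)
        _ = Real.exp ((1 - β) * n) := by
            rw [Real.rpow_def_of_pos hN0, hn_def, mul_comm]
    calc C * (((R : ℝ) - N) ^ (1 - β) * lam₀ ^ (-α))
        ≤ C * (Real.exp ((1 - β) * n) * (q₂ * Real.exp (α * ((j + 2 - lo) * n)))) := by
          apply mul_le_mul_of_nonneg_left _ hC0.le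
          apply mul_le_mul h5 _ (by positivity) (by positivity)
          exact hT2.trans (mul_le_mul_of_nonneg_left (Real.exp_le_exp.2 h4) hq₂0)
      _ = (C * q₂) * (Real.exp ((1 - β) * n) * Real.exp (α * ((j + 2 - lo) * n))) := by ring
      _ ≤ (4.7315 * Real.exp ((β - (j + 2 - lo) * α - 1 / (133.66 * lo ^ 2)) * n))
            * (Real.exp ((1 - β) * n) * Real.exp (α * ((j + 2 - lo) * n))) :=
          mul_le_mul_of_nonneg_right hexp₂ (by positivity)
      _ = 4.7315 * (Real.exp ((β - (j + 2 - lo) * α - 1 / (133.66 * lo ^ 2)) * n)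
            * Real.exp ((1 - β) * n) * Real.exp (α * ((j + 2 - lo) * n))) := by ring
      _ = 4.7315 * Real.exp (n + -(n / (133.66 * lo ^ 2))) := by
          rw [← Real.exp_add, ← Real.exp_add]; congr 1; ring
      _ = 4.7315 * N * Real.exp (-(n / (133.66 * lo ^ 2))) := by
          rw [Real.exp_add, hNexp]; ring
  -- Step 5: exp(-n/(133.66 lo²)) ≤ exp(-n³/(133.66 L²))
  have hfin : Real.exp (-(n / (133.66 * lo ^ 2))) ≤ Real.exp (-(n ^ 3 / (133.66 * L ^ 2))) := by
    apply Real.exp_le_exp.2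
    have hL0 : 0 < L := lt_of_lt_of_le (by positivity) hlo
    have h6 : n ^ 3 / (133.66 * L ^ 2) ≤ n / (133.66 * lo ^ 2) := by
      rw [div_le_div_iff₀ (by positivity) (by positivity)]
      have h7 : (lo * n) ^ 2 ≤ L ^ 2 := pow_le_pow_left₀ (by positivity) hlo 2
      have h8 := mul_le_mul_of_nonneg_left h7 (by positivity : (0 : ℝ) ≤ 133.66 * n)
      calc n ^ 3 * (133.66 * lo ^ 2) = 133.66 * n * (lo * n) ^ 2 := by ring
        _ ≤ 133.66 * n * L ^ 2 := h8
        _ = n * (133.66 * L ^ 2) := by ring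
    linarith
  calc ‖∑ n ∈ Finset.Ioc N R, ((n : ℂ) + u) ^ (-(t * Complex.I))‖
      ≤ C * (((R : ℝ) - N) * lam₀ ^ α + ((R : ℝ) - N) ^ (1 - β) * lam₀ ^ (-α)) := hvdc
    _ = C * (((R : ℝ) - N) * lam₀ ^ α) + C * (((R : ℝ) - N) ^ (1 - β) * lam₀ ^ (-α)) := by ring
    _ ≤ 4.7315 * N * Real.exp (-(n / (133.66 * lo ^ 2)))
        + 4.7315 * N * Real.exp (-(n / (133.66 * lo ^ 2))) := add_le_add hA hB
    _ = 9.463 * N * Real.exp (-(n / (133.66 * lo ^ 2))) := by ring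
    _ ≤ 9.463 * N * Real.exp (-(n ^ 3 / (133.66 * L ^ 2))) :=
        mul_le_mul_of_nonneg_left hfin (by positivity)


/-! ## Certificates for the four `λ`-intervals and the assembly for `1 ≤ λ ≤ 8` -/

/-- `π > 3` in the first certificate inequality. [folklore] -/
theorem cert_pi_lower {F A B : ℝ} (hF : 0 ≤ F) (hA : 0 < A) (h : F / (6 * A) ≤ B) :
    F / (2 * π * A) ≤ B := by
  refine le_trans ?_ h
  apply div_le_div_of_nonneg_left hF (by positivity)
  nlinarith [Real.pi_gt_three]

/-- `π < 3.15` in the second certificate inequality. [folklore] -/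
theorem cert_pi_upper {F A B : ℝ} (hF : 0 < F) (hA : 0 ≤ A) (h : 2 * 3.15 * A / F ≤ B) :
    2 * π * A / F ≤ B := by
  refine le_trans ?_ h
  apply div_le_div_of_nonneg_right _ hF.le
  nlinarith [Real.pi_lt_d2]

/-- `e^{2.2473} ≤ 9.463`, i.e. `log 9.463 ≥ 2.2473`. [folklore] -/
theorem exp_22473_le : Real.exp 2.2473 ≤ 9.463 := by
  have := VK.exp_le_of_expUB_le (k := 2) (f := 0.2473) (X := 9.463) (by norm_num) (by norm_num)
    (by norm_num [VK.expUB])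
  convert this using 2; norm_num

/-- `‖x^{-it}‖ = 1` for real `x > 0`. [folklore] -/
theorem norm_ofReal_cpow_neg_mul_I {x : ℝ} (hx : 0 < x) (t : ℝ) :
    ‖(x : ℂ) ^ (-(t * Complex.I))‖ = 1 := by
  rw [Complex.norm_cpow_eq_rpow_re_of_pos hx]
  simp

/-- The trivial bound `‖∑_{N<n≤R} (n+u)^{-it}‖ ≤ R - N ≤ N` (`R ≤ 2N`, `u > 0`). [folklore] -/
theorem norm_shifted_sum_le_trivial {N R : ℕ} (hR : R ≤ 2 * N) {t u : ℝ} (hu0 : 0 < u) :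
    ‖∑ n ∈ Finset.Ioc N R, ((n : ℂ) + u) ^ (-(t * Complex.I))‖ ≤ N := by
  calc ‖∑ n ∈ Finset.Ioc N R, ((n : ℂ) + u) ^ (-(t * Complex.I))‖
      ≤ ∑ n ∈ Finset.Ioc N R, ‖((n : ℂ) + u) ^ (-(t * Complex.I))‖ := norm_sum_le _ _
    _ = ∑ n ∈ Finset.Ioc N R, (1 : ℝ) := by
        refine Finset.sum_congr rfl fun n _ => ?_
        have hx : 0 < (n : ℝ) + u := by positivity
        have := norm_ofReal_cpow_neg_mul_I hx t
        push_cast at this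
        exact this
    _ = ((R - N : ℕ) : ℝ) := by simp
    _ ≤ N := by
        have : R - N ≤ N := by omega
        exact_mod_cast this

set_option exponentiation.threshold 600 in
/-- **Ford's Theorem 2 in the range `1 ≤ λ ≤ 8`, proved.** For integers `1 ≤ N < R ≤ 2N` and reals
`N ≤ t ≤ N⁸`, `0 < u ≤ 1`:
`‖∑_{N<n≤R} (n+u)^{-it}‖ ≤ 9.463 N^{1 - (log N)²/(133.66 (log t)²)}` (`= 9.463 N^{1-1/(133.66λ²)}`,
`λ = log t/log N`). The source proves this range (indeed `1 ≤ λ ≤ 87`) by Weyl's and Vinogradov's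
methods (Lemmas 6.2, 6.8); here it follows from van der Corput's `k`-th derivative tests with
`k = 3, 6, 8, 9` on `λ ∈ [1, 2.8], [2.8, 5.5], [5.5, 7.3], [7.3, 8]` (`piece_bound`), the bound
being weaker than the trivial one unless `log N > 300.37 λ²`.
[cite: Ford2002, Theorem 2 (the range 1 ≤ λ ≤ 8)] -/
theorem expSum_bound_small_lambda (N R : ℕ) (t u : ℝ) (hN : 1 ≤ N) (hNt : (N : ℝ) ≤ t)
    (ht8 : t ≤ (N : ℝ) ^ 8) (hu0 : 0 < u) (hu1 : u ≤ 1) (hNR : N < R) (hR : R ≤ 2 * N) :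
    ‖∑ n ∈ Finset.Ioc N R, ((n : ℂ) + u) ^ (-(t * Complex.I))‖
      ≤ 9.463 * (N : ℝ) ^ (1 - Real.log N ^ 2 / (133.66 * Real.log t ^ 2)) := by
  have hN0 : 0 < (N : ℝ) := by exact_mod_cast hN
  have ht0 : 0 < t := lt_of_lt_of_le hN0 hNt
  have hrhs : (N : ℝ) ^ (1 - Real.log N ^ 2 / (133.66 * Real.log t ^ 2))
      = N * Real.exp (-(Real.log N ^ 3 / (133.66 * Real.log t ^ 2))) := by
    rw [Real.rpow_def_of_pos hN0,
      show Real.log N * (1 - Real.log N ^ 2 / (133.66 * Real.log t ^ 2))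
        = Real.log N + -(Real.log N ^ 3 / (133.66 * Real.log t ^ 2)) by ring,
      Real.exp_add, Real.exp_log hN0]
  rw [hrhs, ← mul_assoc]
  by_cases htriv : 1 ≤ 9.463 * Real.exp (-(Real.log N ^ 3 / (133.66 * Real.log t ^ 2)))
  · calc ‖∑ n ∈ Finset.Ioc N R, ((n : ℂ) + u) ^ (-(t * Complex.I))‖ ≤ N :=
          norm_shifted_sum_le_trivial hR hu0
      _ = (N : ℝ) * 1 := (mul_one _).symm
      _ ≤ (N : ℝ) * (9.463 * Real.exp (-(Real.log N ^ 3 / (133.66 * Real.log t ^ 2)))) :=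
          mul_le_mul_of_nonneg_left htriv hN0.le
      _ = 9.463 * N * Real.exp (-(Real.log N ^ 3 / (133.66 * Real.log t ^ 2))) := by ring
  push Not at htriv
  set n : ℝ := Real.log N with hn_def
  set L : ℝ := Real.log t with hL_def
  have hL1 : n ≤ L := Real.log_le_log hN0 hNt
  have hL8 : L ≤ 8 * n := by
    have := Real.log_le_log ht0 ht8
    rwa [Real.log_pow] at this
  have hx : 2.2473 < n ^ 3 / (133.66 * L ^ 2) := by
    by_contra hcon
    push Not at hcon
    have h1 : Real.exp (n ^ 3 / (133.66 * L ^ 2)) ≤ 9.463 :=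
      (Real.exp_le_exp.2 hcon).trans exp_22473_le
    have h2 : 1 ≤ 9.463 * Real.exp (-(n ^ 3 / (133.66 * L ^ 2))) := by
      rw [Real.exp_neg, ← div_eq_mul_inv, le_div_iff₀ (Real.exp_pos _)]
      linarith
    exact absurd h2 (not_le.2 htriv)
  have hLpos : 0 < L := by
    rcases lt_or_ge 0 L with h | h
    · exact h
    · have hL0 : L = 0 := le_antisymm h ((Real.log_nonneg (by exact_mod_cast hN)).trans hL1)
      rw [hL0] at hx; norm_num at hx
  have hnpos : 0 < n := by
    rcases lt_or_ge 0 n with h | h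
    · exact h
    · have hn0 : n = 0 := le_antisymm h (Real.log_nonneg (by exact_mod_cast hN))
      rw [hn0] at hx; norm_num at hx
  -- `log N ≥ 300.3 lo²` as soon as `lo log N ≤ log t`
  have key : ∀ lo : ℝ, 0 < lo → lo * n ≤ L → 300.3 * lo ^ 2 ≤ n := by
    intro lo hlo0 hlo
    have h1 : 2.2473 * (133.66 * L ^ 2) < n ^ 3 := (lt_div_iff₀ (by positivity)).1 hx
    have h2 : (lo * n) ^ 2 ≤ L ^ 2 := pow_le_pow_left₀ (by positivity) hlo 2
    have h3 : (2.2473 * 133.66 * lo ^ 2) * n ^ 2 < n * n ^ 2 := by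
      calc (2.2473 * 133.66 * lo ^ 2) * n ^ 2 = 2.2473 * (133.66 * (lo * n) ^ 2) := by ring
        _ ≤ 2.2473 * (133.66 * L ^ 2) := by nlinarith [h2]
        _ < n ^ 3 := h1
        _ = n * n ^ 2 := by ring
    have h4 : 2.2473 * 133.66 * lo ^ 2 < n := lt_of_mul_lt_mul_right h3 (by positivity)
    nlinarith [h4]
  rcases le_or_gt L (2.8 * n) with h28 | h28
  · exact piece_bound 1 (lo := 1) (hi := 2.8) (q₁ := 1) (q₂ := 2.5) (m₁ := 7) (m₂ := 7)
      hN hNR hR ht0 hu0 hu1 one_pos (by linarith) h28 (key 1 one_pos (by linarith))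
      (by norm_num) (by norm_num) (cert_pi_lower (by positivity) (by positivity)
        (by norm_num [Nat.factorial])) (by norm_num)
      (by norm_num) (by norm_num) (cert_pi_upper (by positivity) (by positivity)
        (by norm_num [Nat.factorial])) (by norm_num)
  rcases le_or_gt L (5.5 * n) with h55 | h55
  · exact piece_bound 4 (lo := 2.8) (hi := 5.5) (q₁ := 1) (q₂ := 1.1) (m₁ := 15) (m₂ := 15)
      hN hNR hR ht0 hu0 hu1 (by norm_num) h28.le h55 (key 2.8 (by norm_num) h28.le)
      (by norm_num) (by norm_num) (cert_pi_lower (by positivity) (by positivity)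
        (by norm_num [Nat.factorial])) (by norm_num)
      (by norm_num) (by norm_num) (cert_pi_upper (by positivity) (by positivity)
        (by norm_num [Nat.factorial])) (by norm_num)
  rcases le_or_gt L (7.3 * n) with h73 | h73
  · exact piece_bound 6 (lo := 5.5) (hi := 7.3) (q₁ := 1.005) (q₂ := 1.02) (m₁ := 21) (m₂ := 21)
      hN hNR hR ht0 hu0 hu1 (by norm_num) h55.le h73 (key 5.5 (by norm_num) h55.le)
      (by norm_num) (by norm_num) (cert_pi_lower (by positivity) (by positivity)
        (by norm_num [Nat.factorial])) (by norm_num)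
      (by norm_num) (by norm_num) (cert_pi_upper (by positivity) (by positivity)
        (by norm_num [Nat.factorial])) (by norm_num)
  · exact piece_bound 7 (lo := 7.3) (hi := 8) (q₁ := 1.006) (q₂ := 1.01) (m₁ := 27) (m₂ := 27)
      hN hNR hR ht0 hu0 hu1 (by norm_num) h73.le hL8 (key 7.3 (by norm_num) h73.le)
      (by norm_num) (by norm_num) (cert_pi_lower (by positivity) (by positivity)
        (by norm_num [Nat.factorial])) (by norm_num)
      (by norm_num) (by norm_num) (cert_pi_upper (by positivity) (by positivity)
        (by norm_num [Nat.factorial])) (by norm_num)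

end FordVK

open FordVK in
/-- **Ford's Theorem 1 from Ford's Theorem 2 in the range `λ ≥ 8` only.** Since the range
`1 ≤ λ ≤ 8` of Theorem 2 is proved in the tree (`FordVK.expSum_bound_small_lambda`), the
hypothesis of `zeta_bound_ford_of_exp_sum_bound` may be restricted to `t ≥ N⁸`: if
`‖∑_{N<n≤R} (n+u)^{-it}‖ ≤ 9.463 N^{1 - (log N)²/(133.66 (log t)²)}` for all integers
`1 ≤ N < R ≤ 2N` and reals `t ≥ N⁸`, `0 < u ≤ 1` (Theorem 2 of the source for `λ ≥ 8`, whose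
printed proof is §5 — Theorems 3, 4 and Lemmas 5.1–5.3 — for `λ ≥ 87` and Lemmas 6.3–6.8 for
`8 ≤ λ ≤ 87`), then `zeta_bound_ford` (Theorem 1 of the source) holds.
[cite: Ford2002, Theorem 1 (proof, §7) and Theorem 2] -/
theorem zeta_bound_ford_of_exp_sum_bound_large_lambda
    (hT2 : ∀ (N R : ℕ) (t u : ℝ), 1 ≤ N → (N : ℝ) ^ 8 ≤ t → 0 < u → u ≤ 1 → N < R → R ≤ 2 * N →
      ‖∑ n ∈ Finset.Ioc N R, ((n : ℂ) + u) ^ (-(t * Complex.I))‖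
        ≤ 9.463 * (N : ℝ) ^ (1 - Real.log N ^ 2 / (133.66 * Real.log t ^ 2))) :
    zeta_bound_ford :=
  zeta_bound_ford_of_exp_sum_bound fun N R t u hN hNt hu0 hu1 hNR hR => by
    rcases le_or_gt t ((N : ℝ) ^ 8) with h8 | h8
    · exact expSum_bound_small_lambda N R t u hN hNt h8 hu0 hu1 hNR hR
    · exact hT2 N R t u hN h8.le hu0 hu1 hNR hR

end Literature.NumberTheory.LFunctions
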